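/-
Copyright: cell `pub-ymgap` (HUMAN RULING D-0062), Track A of `YM-PLAN.md`, DAG node N20 (= NE7b); R134 acceleration seat
`pub-ymgap-dag-n20-c` (strategy s1, generation 2), module 8.  Released under the licence of the surrounding project.
-/
import Summits.QuantumFields.YangMills.Theorems.BalabanUVNodesN20LCSAtRecordLevelZero
import Literature.MathematicalPhysics.QuantumFieldTheory.Balaban1983to89.TorusHypercubicSymmetry
import HarnessLib

/-!
# YM-DAG node N20 (= NE7b), strategy s1, module 8: REFLECTION POSITIVITY SURVIVES THE SMALL-FIELD RESTRICTION AT LEVEL 0 —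
# the plaquette-weighted (in particular small-field-RESTRICTED) level-0 state of record is Osterwalder–Seiler positive for the
# SITE reflections (first brick of the located residual (ii) «LCS-j in the history term's own state = a restricted-measure chessboard»)

Track A of `YM-PLAN.md` (cell `pub-ymgap`, HUMAN RULING D-0062), node **N20** = spine estimate NE7b (`T4WeightBudget.RelWeightBound` — the
cell `pub-balaban`'s OWN estimate, NOT PRINTED in [Bałaban 1983–89], NOT PROVED).  Seat `pub-ymgap-dag-n20-c` (R134, s1), module 8
(module 7: `…Theorems.BalabanUVNodesN20LCSAtRecordLevelZero`).  Kernel theorems only: 0 `def`, 0 `sorry`, standard axioms; COUNT-NEUTRAL;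
`--supports` the K3 item `SpineGivenEndpointR11` (stmt-QuantumFields-19676).  Nothing of Bałaban's is asserted: the objects are the cell's
(`Missing.expect`, `GaugeField.negReflect`, `PosHalfSupported` of `TorusReflectionPositivity`; the host tree's site-reflection geometry
`WilsonSiteRP.{IsSitePosPlaq, IsSharedPlaq, IsSiteNegPlaq, sitePlaqReflect, plaqRe_negReflect, edges_of_isSitePosPlaq, …}` of
`ConstructiveQFTWave0SiteRPProofs`), read BY NAME.

WHY.  Module 7 closed «LCS-j» at level 0 (the first 𝐑𝐓 step's own state `ρ₀·∏dU`).  From level 1 on, `LocalConditionalStability` asks the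
moment bound in the HISTORY TERM's own state, i.e. for the Wilson weight RESTRICTED by the earlier steps' small-field characteristic
functions — located residual (ii) of modules 1∕6: a chessboard estimate for a restricted state.  Its two inputs are (a) reflection
positivity of the restricted state and (b) a restricted uniform doubling.  THIS FILE settles (a) at level 0, for the reflections that DO
survive: the SITE reflections `Θ'` in the lattice hyperplanes `t = 0`, `t = N₀∕2` (Osterwalder–Seiler).  A product `∏_p w(1 − Re tr U(∂p))` of
ONE non-negative weight over ALL plaquettes splits into positive, shared and negative plaquettes (`prod_eq_pos_mul_shared_mul_neg`); `Θ'`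
carries the positive part onto the negative part (`prod_pos_negReflect`, from the tree's `plaqRe_negReflect` and the bijection
`sitePlaqReflect`), fixes the shared part (`plaqRe_negReflect_of_isSharedPlaq`: the four links of a shared plaquette are shared links), and
the shared part is `√S·√S`; so `⟨(F∘Θ')·F·∏_p w⟩ = ⟨(F'∘Θ')·F'⟩` with `F' = F·∏_{pos} w·√S` positive-half supported, and the tree's
`Missing.expect_negReflect_mul_nonneg_SU` gives the sign.  (LINK reflections, through `t = ½`, do NOT survive an all-plaquette restriction:
temporal plaquettes cross the plane — the tree's even-torus chessboards `PlaquetteProductRPCS.rpcs_link`, `WilsonPlaquetteChessboardEvenSide`,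
`FdVOC22MultiReflectionBound.chessboard_of_reflectionCS` and the W-RP road `Support/HistoryRP*` (`rpPackage_wilson`: `timeReflect` between
the slices `0 ∣ 1`; `HistoryRPGibbs`: the centre reflections `creflect`) use them; none is used here.)
* §1 (host torus `(ℤ∕L)^d`, `L` even, any compact `G`, continuous `ρ`): `prod_eq_pos_mul_shared_mul_neg`, **`prod_pos_negReflect`**,
  **`plaqRe_negReflect_of_isSharedPlaq`**, `plaqRe_congr_of_isSitePosPlaq`, `plaqRe_congr_of_isSharedPlaq`.
* §3 (v1.1) EVERY AXIS: `prod_plaqWeight_permute`, **`expect_conjNegReflect_mul_mul_prod_nonneg`** (the conjugate site reflection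
  `π ∘ Θ' ∘ π⁻¹` of any coordinate permutation `π`; `π = swap 0 μ` = the axis `μ`), `expect_axisNegReflect_mul_mul_smallField_nonneg`.
* §2 (AT THE RECORD: Bałaban's `T^{(0)}` of any `P : Params`, `SU(N)`, every real `β`): `isPosHalfBond_of_pos_or_shared`, `toConfig_negReflect`,
  `one_sub_reTr_eq`; ★ **`expect_negReflect_mul_mul_prod_nonneg`** — `0 ≤ ⟨(F∘Θ')·F·∏_p w(1 − Re tr U(∂p))⟩_{P,β}` for every non-negative
  bounded measurable `w` and every bounded measurable positive-half-supported real `F`; **`expect_negReflect_mul_mul_smallField_nonneg`**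
  (`w = 𝟙[· ≤ ε]`: Bałaban's all-plaquette small-field characteristic function [Balaban1989LargeFieldI] (0.1)∕(0.3) keeps OS positivity);
  **`expect_negReflect_mul_mul_expSmallField_nonneg`** (`w(t) = e^{a t}𝟙[t ≤ ε]`, `a ≥ 0`: the restricted state dressed by module 7's
  plaquette-energy carrier over all plaquettes is still positive — the shape a conditional chessboard consumes).

HONEST FRAMING.  Positivity only, at level 0, for the site reflections of the TIME axis (the other axes are conjugates by the exact axis
symmetry `TorusHypercubicSymmetry` ∕ `configPerm`, not typed here).  NOT here: the chessboard ITERATION for site reflections in all four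
directions with non-negative site-indexed observables (not in the tree — its even chessboards iterate link reflections transversally),
the restricted uniform doubling `Z_ε(β∕2) ≤ e^{AL⁴}Z_ε(β)` (located in `N20-S1-TRIAGE.md`: `TorusLowerAxis.twist_lower_master` re-run with
the restriction), levels `≥ 1` (the W-RP road `Support/HistoryRPTower*` carries RP through the averaging steps for UNRESTRICTED tower laws),
residual (i) and (iv).  NE7b NOT PRINTED ∕ NOT PROVED; (α)-instance 0∕1; N20 NOT discharged; typed 28∕28, discharged count untouched; one
finite four-torus at fixed `ε` — NOT ℝ⁴, NOT infinite volume, NOT OS axioms for fields, NOT a mass gap, NOT Clay.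
-/

set_option autoImplicit false

noncomputable section

namespace Summit.QuantumFields.YangMills.BalabanUVNodes.N20LCSRestrictedRP

open MeasureTheory
open Literature.MathematicalPhysics.QuantumFieldTheory
open Literature.MathematicalPhysics.QuantumFieldTheory.WilsonSiteRP
open Literature.MathematicalPhysics.QuantumFieldTheory.Balaban1983to89
open Literature.MathematicalPhysics.QuantumLattice (fundamentalRep continuous_fundamentalRep)
open Summit.QuantumFields.YangMills.BalabanUVNodes.N20LCSAtRecordLevelZero (plaqEnergy_ofConfig)

/-! ## §1 Host torus `(ℤ∕L)^d`, `L` even: the three parts of a plaquette-weight product under the site reflection `Θ'` -/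

section Host

variable {d L N : ℕ} [NeZero d] [NeZero L] [Fact (1 < L)]
variable {G : Type*} [Group G] [TopologicalSpace G] [IsTopologicalGroup G] [CompactSpace G] [MeasurableSpace G] [BorelSpace G]
variable (ρ : G →* Matrix (Fin N) (Fin N) ℂ)

omit [Fact (1 < L)] [TopologicalSpace G] [IsTopologicalGroup G] [CompactSpace G] [MeasurableSpace G] [BorelSpace G] in
/-- A product over all plaquettes splits into its positive, shared and negative parts (`IsSitePosPlaq`, `IsSharedPlaq`,
`IsSiteNegPlaq` of the tree's site-reflection geometry). [folklore] -/
theorem prod_eq_pos_mul_shared_mul_neg (f : Plaquette d L → ℝ) :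
    ∏ p, f p = (∏ p ∈ Finset.univ.filter IsSitePosPlaq, f p) * (∏ p ∈ Finset.univ.filter IsSharedPlaq, f p) *
      ∏ p ∈ Finset.univ.filter IsSiteNegPlaq, f p := by
  classical
  rw [← Finset.prod_filter_mul_prod_filter_not Finset.univ IsSitePosPlaq f, mul_assoc]
  congr 1
  rw [← Finset.prod_filter_mul_prod_filter_not (Finset.univ.filter fun p => ¬ IsSitePosPlaq p) IsSharedPlaq f,
    Finset.filter_filter, Finset.filter_filter]
  have hC : (Finset.univ.filter fun p : Plaquette d L => ¬ IsSitePosPlaq p ∧ IsSharedPlaq p) =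
      Finset.univ.filter IsSharedPlaq :=
    Finset.filter_congr fun p _ => ⟨fun h => h.2, fun h => ⟨not_isSitePosPlaq_of_isSharedPlaq h, h⟩⟩
  have hN : (Finset.univ.filter fun p : Plaquette d L => ¬ IsSitePosPlaq p ∧ ¬ IsSharedPlaq p) =
      Finset.univ.filter IsSiteNegPlaq :=
    Finset.filter_congr fun p _ => Iff.rfl
  rw [hC, hN]

omit [MeasurableSpace G] [BorelSpace G] in
/-- **THE POSITIVE PART REFLECTS ONTO THE NEGATIVE PART**: `∏_{p pos} g(Re tr ρ((Θ'U)_p)) = ∏_{p neg} g(Re tr ρ(U_p))`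
(`plaqRe_negReflect` and the bijection `sitePlaqReflect : pos → neg`). [folklore] -/
theorem prod_pos_negReflect (hL : Even L) (hρ : Continuous ρ) (g : ℝ → ℝ) (U : GaugeConfig d L G) :
    ∏ p ∈ Finset.univ.filter IsSitePosPlaq, g (WilsonRP.plaqRe ρ U.negReflect p) =
      ∏ p ∈ Finset.univ.filter IsSiteNegPlaq, g (WilsonRP.plaqRe ρ U p) := by
  classical
  simp_rw [plaqRe_negReflect ρ hρ]
  refine Finset.prod_equiv sitePlaqReflectEquiv (fun p => ?_) (fun p _ => rfl)
  simp only [Finset.mem_filter, Finset.mem_univ, true_and]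
  exact (isSiteNegPlaq_sitePlaqReflect_iff hL p).symm

omit [Fact (1 < L)] [TopologicalSpace G] [IsTopologicalGroup G] [CompactSpace G] [MeasurableSpace G] [BorelSpace G] in
/-- **THE SHARED PART IS REFLECTION INVARIANT**: the holonomy of a shared plaquette is untouched by `Θ'` (its four links are
shared links, fixed by `Θ'`: `negReflect_apply_of_mem_sharedEdges`). [folklore] -/
theorem plaqRe_negReflect_of_isSharedPlaq (hL : Even L) (U : GaugeConfig d L G) {p : Plaquette d L} (hp : IsSharedPlaq p) :
    WilsonRP.plaqRe ρ U.negReflect p = WilsonRP.plaqRe ρ U p := by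
  obtain ⟨h1, h2, h3, h4⟩ := edges_of_isSharedPlaq hp
  have h : ∀ e, IsSharedEdge e → U.negReflect e = U e := fun e he =>
    negReflect_apply_of_mem_sharedEdges hL U e (by simp [he])
  simp only [WilsonRP.plaqRe, plaquetteHolonomy, h _ h1, h _ h2, h _ h3, h _ h4]

omit [TopologicalSpace G] [IsTopologicalGroup G] [CompactSpace G] [MeasurableSpace G] [BorelSpace G] in
/-- A positive plaquette's holonomy depends only on the positive and shared links (`edges_of_isSitePosPlaq`). [folklore] -/
theorem plaqRe_congr_of_isSitePosPlaq (hL : Even L) {U V : GaugeConfig d L G}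
    (hUV : ∀ e, IsSitePosEdge e ∨ IsSharedEdge e → U e = V e) {p : Plaquette d L} (hp : IsSitePosPlaq p) :
    WilsonRP.plaqRe ρ U p = WilsonRP.plaqRe ρ V p := by
  obtain ⟨h1, h2, h3, h4⟩ := edges_of_isSitePosPlaq hL hp
  simp only [WilsonRP.plaqRe, plaquetteHolonomy, hUV _ h1, hUV _ h2, hUV _ h3, hUV _ h4]

omit [Fact (1 < L)] [NeZero L] [TopologicalSpace G] [IsTopologicalGroup G] [CompactSpace G] [MeasurableSpace G]
  [BorelSpace G] in
/-- A shared plaquette's holonomy depends only on the shared links (`edges_of_isSharedPlaq`). [folklore] -/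
theorem plaqRe_congr_of_isSharedPlaq {U V : GaugeConfig d L G}
    (hUV : ∀ e, IsSitePosEdge e ∨ IsSharedEdge e → U e = V e) {p : Plaquette d L} (hp : IsSharedPlaq p) :
    WilsonRP.plaqRe ρ U p = WilsonRP.plaqRe ρ V p := by
  obtain ⟨h1, h2, h3, h4⟩ := edges_of_isSharedPlaq hp
  simp only [WilsonRP.plaqRe, plaquetteHolonomy, hUV _ (Or.inr h1), hUV _ (Or.inr h2), hUV _ (Or.inr h3),
    hUV _ (Or.inr h4)]

end Host

/-! ## §2 AT THE RECORD: the plaquette-weighted level-0 state of Bałaban's `T^{(0)}` (`SU(N)`) is reflection positive -/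

section Record

variable {N : ℕ} [NeZero N]

/-- Positive-or-shared links of the host torus are positive-half bonds of `Setup` (`IsPosHalfBond`). [folklore] -/
theorem isPosHalfBond_of_pos_or_shared (P : Params) {e : Edge P.d (P.sitesPerDir 0)}
    (he : IsSitePosEdge e ∨ IsSharedEdge e) : IsPosHalfBond (⟨e.1, e.2⟩ : PBond P 0) := by
  unfold IsPosHalfBond
  unfold IsSitePosEdge IsSharedEdge at he
  by_cases hd : e.2 = 0
  · simp only [hd, ↓reduceIte, ne_eq, not_true_eq_false, false_and, or_false] at he ⊢
    exact he
  · simp only [hd, ↓reduceIte, ne_eq, not_false_eq_true, true_and] at he ⊢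
    have hlt := ZMod.val_lt (e.1 0)
    omega

/-- `toConfig` intertwines the two site reflections: `toConfig (Θ'U) = Θ'(toConfig U)`. [folklore] -/
theorem toConfig_negReflect (P : Params) (U : GaugeField P 0 (Matrix.specialUnitaryGroup (Fin N) ℂ)) :
    toConfig U.negReflect = (toConfig U).negReflect := rfl

/-- The cell's plaquette energy through the host's: `1 − Re tr U(∂p) = (N − Re tr ρ((toConfig U)_{plaqEquiv p}))∕N`. [folklore] -/
theorem one_sub_reTr_eq (P : Params) (U : GaugeField P 0 (Matrix.specialUnitaryGroup (Fin N) ℂ)) (p : Plaq P 0) :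
    1 - reTr (GaugeField.plaqHol U p) =
      ((N : ℝ) - WilsonRP.plaqRe (fundamentalRep (Fin N)) (toConfig U) (plaqEquiv 0 p)) / N := by
  have hN : (N : ℝ) ≠ 0 := Nat.cast_ne_zero.mpr (NeZero.ne N)
  have h := plaqEnergy_ofConfig (N := N) P (toConfig U) p
  rw [ofConfig_toConfig] at h
  rw [h, mul_div_cancel_left₀ _ hN]

/-- **REFLECTION POSITIVITY OF THE PLAQUETTE-WEIGHTED LEVEL-0 STATE OF RECORD** (site reflections `Θ'` in the lattice
hyperplanes `t = 0`, `t = N₀∕2`).  For every parameter set `P`, every real `β`, every non-negative bounded measurable weight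
`w : ℝ → ℝ` and every bounded measurable real observable `F` supported in the closed positive-time half:
`0 ≤ ⟨(F ∘ Θ')·F·∏_p w(1 − Re tr U(∂p))⟩_{P,β}` — the level-0 torus expectation dressed by ANY reflection-symmetric product of
one-plaquette weights (the same `w` at every plaquette) is Osterwalder–Seiler positive.  Mechanism: the product splits into
positive, shared and negative plaquettes (`prod_eq_pos_mul_shared_mul_neg`); the positive part reflects onto the negative part
(`prod_pos_negReflect`), the shared part is `Θ'`-invariant (`plaqRe_negReflect_of_isSharedPlaq`) and is written `√S·√S`; so the
dressed pairing is the plain pairing of `F' = F·∏_{pos} w·√(∏_{shared} w)`, positive-half supported, and the tree's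
`Missing.expect_negReflect_mul_nonneg_SU` applies.  (LINK reflections do NOT survive an all-plaquette restriction — temporal
plaquettes cross the plane; this file uses none.) [folklore] -/
theorem expect_negReflect_mul_mul_prod_nonneg (P : Params) (β : ℝ) {w : ℝ → ℝ} (hw0 : ∀ t, 0 ≤ w t)
    (hwm : Measurable w) (hwb : ∃ K : ℝ, ∀ t, w t ≤ K)
    {F : GaugeField P 0 (Matrix.specialUnitaryGroup (Fin N) ℂ) → ℝ} (hF : Measurable F)
    (hFb : ∃ C : ℝ, ∀ U, |F U| ≤ C) (hFpos : PosHalfSupported F) :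
    0 ≤ Missing.expect (G := Matrix.specialUnitaryGroup (Fin N) ℂ) P β
      (fun U => F U.negReflect * F U * ∏ p : Plaq P 0, w (1 - reTr (GaugeField.plaqHol U p))) := by
  classical
  have hL : Even (P.sitesPerDir 0) := even_sitesPerDir P 0
  have hρ : Continuous (fundamentalRep (Fin N)) := continuous_fundamentalRep (Fin N)
  obtain ⟨K, hK⟩ := hwb
  obtain ⟨C, hC⟩ := hFb
  have hK0 : 0 ≤ K := (hw0 0).trans (hK 0)
  -- the host weight `g(s) = w((N − s)/N)` of one plaquette value `s = Re tr ρ(U_p)`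
  set g : ℝ → ℝ := fun s => w (((N : ℝ) - s) / N) with hg
  have hg0 : ∀ s, 0 ≤ g s := fun s => hw0 _
  have hgK : ∀ s, g s ≤ K := fun s => hK _
  have hgm : Measurable g := hwm.comp ((measurable_const.sub measurable_id).div_const _)
  -- positive part `D₊`, shared part `S`, and the new observable `F' = F · D₊ · √S`
  set Dp : GaugeField P 0 (Matrix.specialUnitaryGroup (Fin N) ℂ) → ℝ := fun U =>
    ∏ q ∈ Finset.univ.filter IsSitePosPlaq, g (WilsonRP.plaqRe (fundamentalRep (Fin N)) (toConfig U) q) with hDp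
  set S : GaugeField P 0 (Matrix.specialUnitaryGroup (Fin N) ℂ) → ℝ := fun U =>
    ∏ q ∈ Finset.univ.filter IsSharedPlaq, g (WilsonRP.plaqRe (fundamentalRep (Fin N)) (toConfig U) q) with hS
  set F' : GaugeField P 0 (Matrix.specialUnitaryGroup (Fin N) ℂ) → ℝ := fun U => F U * Dp U * Real.sqrt (S U) with hF'
  have hS0 : ∀ U, 0 ≤ S U := fun U => Finset.prod_nonneg fun q _ => hg0 _
  have hDp0 : ∀ U, 0 ≤ Dp U := fun U => Finset.prod_nonneg fun q _ => hg0 _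
  -- (1) the dressed pairing is the plain pairing of `F'`
  have hsplit : ∀ U : GaugeField P 0 (Matrix.specialUnitaryGroup (Fin N) ℂ),
      ∏ p : Plaq P 0, w (1 - reTr (GaugeField.plaqHol U p)) =
        Dp U * S U * ∏ q ∈ Finset.univ.filter IsSiteNegPlaq, g (WilsonRP.plaqRe (fundamentalRep (Fin N)) (toConfig U) q) := by
    intro U
    have h1 : ∏ p : Plaq P 0, w (1 - reTr (GaugeField.plaqHol U p)) =
        ∏ q : Plaquette P.d (P.sitesPerDir 0), g (WilsonRP.plaqRe (fundamentalRep (Fin N)) (toConfig U) q) := by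
      refine Fintype.prod_equiv (plaqEquiv 0) _ _ fun p => ?_
      rw [one_sub_reTr_eq]
    rw [h1, prod_eq_pos_mul_shared_mul_neg]
  have hSinv : ∀ U : GaugeField P 0 (Matrix.specialUnitaryGroup (Fin N) ℂ), S U.negReflect = S U := by
    intro U
    simp only [hS, toConfig_negReflect]
    exact Finset.prod_congr rfl fun q hq =>
      congrArg g (plaqRe_negReflect_of_isSharedPlaq (fundamentalRep (Fin N)) hL (toConfig U) (Finset.mem_filter.1 hq).2)
  have hDpref : ∀ U : GaugeField P 0 (Matrix.specialUnitaryGroup (Fin N) ℂ), Dp U.negReflect =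
      ∏ q ∈ Finset.univ.filter IsSiteNegPlaq, g (WilsonRP.plaqRe (fundamentalRep (Fin N)) (toConfig U) q) := by
    intro U
    simp only [hDp, toConfig_negReflect]
    exact prod_pos_negReflect (fundamentalRep (Fin N)) hL hρ g (toConfig U)
  have hpair : ∀ U : GaugeField P 0 (Matrix.specialUnitaryGroup (Fin N) ℂ),
      F U.negReflect * F U * ∏ p : Plaq P 0, w (1 - reTr (GaugeField.plaqHol U p)) = F' U.negReflect * F' U := by
    intro U
    rw [hsplit U]
    simp only [hF']
    rw [hSinv U, hDpref U]
    have hsq : Real.sqrt (S U) * Real.sqrt (S U) = S U := Real.mul_self_sqrt (hS0 U)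
    calc F U.negReflect * F U * (Dp U * S U *
          ∏ q ∈ Finset.univ.filter IsSiteNegPlaq, g (WilsonRP.plaqRe (fundamentalRep (Fin N)) (toConfig U) q))
        = F U.negReflect * F U * (Dp U * (Real.sqrt (S U) * Real.sqrt (S U)) *
          ∏ q ∈ Finset.univ.filter IsSiteNegPlaq, g (WilsonRP.plaqRe (fundamentalRep (Fin N)) (toConfig U) q)) := by
          rw [hsq]
      _ = F U.negReflect * (∏ q ∈ Finset.univ.filter IsSiteNegPlaq,
            g (WilsonRP.plaqRe (fundamentalRep (Fin N)) (toConfig U) q)) * Real.sqrt (S U) *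
          (F U * Dp U * Real.sqrt (S U)) := by ring
  -- (2) `F'` is bounded, measurable and positive-half supported
  have hmeas_plaq : ∀ q : Plaquette P.d (P.sitesPerDir 0), Measurable fun U : GaugeField P 0 (Matrix.specialUnitaryGroup (Fin N) ℂ) =>
      g (WilsonRP.plaqRe (fundamentalRep (Fin N)) (toConfig U) q) := fun q =>
    hgm.comp ((WilsonRP.measurable_plaqRe (fundamentalRep (Fin N)) hρ q).comp measurable_toConfig)
  have hDpm : Measurable Dp := Finset.measurable_prod _ fun q _ => hmeas_plaq q
  have hSm : Measurable S := Finset.measurable_prod _ fun q _ => hmeas_plaq q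
  have hF'm : Measurable F' := (hF.mul hDpm).mul hSm.sqrt
  have hprod_le : ∀ (s : Finset (Plaquette P.d (P.sitesPerDir 0))) (U : GaugeField P 0 (Matrix.specialUnitaryGroup (Fin N) ℂ)),
      ∏ q ∈ s, g (WilsonRP.plaqRe (fundamentalRep (Fin N)) (toConfig U) q) ≤ K ^ s.card := fun s U => by
    rw [← Finset.prod_const]
    exact Finset.prod_le_prod (fun q _ => hg0 _) fun q _ => hgK _
  have hF'b : ∃ C' : ℝ, ∀ U, |F' U| ≤ C' := by
    refine ⟨C * K ^ (Finset.univ.filter (IsSitePosPlaq (d := P.d) (L := P.sitesPerDir 0))).card *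
      Real.sqrt (K ^ (Finset.univ.filter (IsSharedPlaq (d := P.d) (L := P.sitesPerDir 0))).card), fun U => ?_⟩
    simp only [hF']
    rw [abs_mul, abs_mul, abs_of_nonneg (hDp0 U), abs_of_nonneg (Real.sqrt_nonneg _)]
    have hC0 : 0 ≤ C := (abs_nonneg _).trans (hC U)
    refine mul_le_mul (mul_le_mul (hC U) (hprod_le _ U) (hDp0 U) hC0) (Real.sqrt_le_sqrt (hprod_le _ U))
      (Real.sqrt_nonneg _) (mul_nonneg hC0 (pow_nonneg hK0 _))
  have hF'pos : PosHalfSupported F' := by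
    intro U V hUV
    have hUV' : ∀ e : Edge P.d (P.sitesPerDir 0), IsSitePosEdge e ∨ IsSharedEdge e → toConfig U e = toConfig V e :=
      fun e he => hUV ⟨e.1, e.2⟩ (isPosHalfBond_of_pos_or_shared P he)
    have hD : Dp U = Dp V := Finset.prod_congr rfl fun q hq =>
      congrArg g (plaqRe_congr_of_isSitePosPlaq (fundamentalRep (Fin N)) hL hUV' (Finset.mem_filter.1 hq).2)
    have hSUV : S U = S V := Finset.prod_congr rfl fun q hq =>
      congrArg g (plaqRe_congr_of_isSharedPlaq (fundamentalRep (Fin N)) hUV' (Finset.mem_filter.1 hq).2)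
    simp only [hF']
    rw [hFpos U V hUV, hD, hSUV]
  -- (3) Osterwalder–Seiler positivity of the bare state for `F'`
  have key := Missing.expect_negReflect_mul_nonneg_SU P β hF'm hF'b hF'pos
  have hfun : (fun U => F U.negReflect * F U * ∏ p : Plaq P 0, w (1 - reTr (GaugeField.plaqHol U p))) =
      fun U => F' U.negReflect * F' U := funext hpair
  rw [hfun]
  exact key

/-- **THE SMALL-FIELD-RESTRICTED LEVEL-0 STATE IS REFLECTION POSITIVE** (`w = 𝟙_{(−∞, ε]}`): for every threshold `ε`, every
real `β` and every bounded measurable positive-half-supported `F`,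
`0 ≤ ⟨(F ∘ Θ')·F·∏_p 𝟙[1 − Re tr U(∂p) ≤ ε]⟩_{P,β}` — Bałaban's all-plaquette small-field characteristic function
([Balaban1989LargeFieldI] (0.1)∕(0.3): the densities restricted to small fields) keeps Osterwalder–Seiler positivity for the site
reflections; the first brick of a conditional (restricted-state) chessboard.  Honest scope: positivity only — the chessboard
ITERATION for site reflections in all four directions and the restricted uniform doubling are not here. [folklore] -/
theorem expect_negReflect_mul_mul_smallField_nonneg (P : Params) (β ε : ℝ)
    {F : GaugeField P 0 (Matrix.specialUnitaryGroup (Fin N) ℂ) → ℝ} (hF : Measurable F)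
    (hFb : ∃ C : ℝ, ∀ U, |F U| ≤ C) (hFpos : PosHalfSupported F) :
    0 ≤ Missing.expect (G := Matrix.specialUnitaryGroup (Fin N) ℂ) P β
      (fun U => F U.negReflect * F U * ∏ p : Plaq P 0, (if 1 - reTr (GaugeField.plaqHol U p) ≤ ε then (1 : ℝ) else 0)) := by
  have h := expect_negReflect_mul_mul_prod_nonneg (N := N) P β (w := fun t => if t ≤ ε then (1 : ℝ) else 0)
    (fun t => by split_ifs <;> norm_num)
    (Measurable.ite measurableSet_Iic measurable_const measurable_const) ⟨1, fun t => by split_ifs <;> norm_num⟩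
    hF hFb hFpos
  exact h

/-- The same for the TILTED-and-restricted weights `w(t) = e^{a·t}·𝟙[t ≤ ε]`, `a ≥ 0`: the restricted state dressed by a
plaquette-energy carrier over ALL plaquettes is still reflection positive — the shape in which a conditional chessboard would
consume the level-0 carrier of module 7. [folklore] -/
theorem expect_negReflect_mul_mul_expSmallField_nonneg (P : Params) (β ε : ℝ) {a : ℝ} (ha : 0 ≤ a)
    {F : GaugeField P 0 (Matrix.specialUnitaryGroup (Fin N) ℂ) → ℝ} (hF : Measurable F)
    (hFb : ∃ C : ℝ, ∀ U, |F U| ≤ C) (hFpos : PosHalfSupported F) :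
    0 ≤ Missing.expect (G := Matrix.specialUnitaryGroup (Fin N) ℂ) P β
      (fun U => F U.negReflect * F U *
        ∏ p : Plaq P 0, (if 1 - reTr (GaugeField.plaqHol U p) ≤ ε then Real.exp (a * (1 - reTr (GaugeField.plaqHol U p))) else 0)) := by
  have hw0 : ∀ t : ℝ, 0 ≤ (if t ≤ ε then Real.exp (a * t) else 0) := fun t => by
    split_ifs
    · exact (Real.exp_pos _).le
    · exact le_rfl
  have hwm : Measurable fun t : ℝ => if t ≤ ε then Real.exp (a * t) else 0 :=
    Measurable.ite measurableSet_Iic (Real.measurable_exp.comp (measurable_id.const_mul a)) measurable_const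
  have hwb : ∃ K : ℝ, ∀ t : ℝ, (if t ≤ ε then Real.exp (a * t) else 0) ≤ K := by
    refine ⟨Real.exp (a * ε), fun t => ?_⟩
    split_ifs with ht
    · exact Real.exp_le_exp.2 (mul_le_mul_of_nonneg_left ht ha)
    · exact (Real.exp_pos _).le
  exact expect_negReflect_mul_mul_prod_nonneg (N := N) P β hw0 hwm hwb hF hFb hFpos

end Record


/-! ## §3 (v1.1) EVERY AXIS: the conjugate site reflections `π ∘ Θ' ∘ π⁻¹` (coordinate permutations are exact symmetries of the
torus expectation, `TorusHypercubicSymmetry.Missing.expect_permute`; the all-plaquette weight is permutation invariant,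
`GaugeField.reTr_plaqHol_permute` + `Plaq.permuteEquiv`) -/

section AllAxes

variable {N : ℕ} [NeZero N]

/-- The all-plaquette weight is invariant under coordinate permutations of the configuration. [folklore] -/
theorem prod_plaqWeight_permute (P : Params) (w : ℝ → ℝ) (π : Equiv.Perm (Fin P.d))
    (V : GaugeField P 0 (Matrix.specialUnitaryGroup (Fin N) ℂ)) :
    ∏ p : Plaq P 0, w (1 - reTr (GaugeField.plaqHol (V.permute π) p)) =
      ∏ p : Plaq P 0, w (1 - reTr (GaugeField.plaqHol V p)) := by
  simp_rw [GaugeField.reTr_plaqHol_permute]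
  exact Fintype.prod_equiv (Plaq.permuteEquiv π) _ _ fun p => rfl

/-- **REFLECTION POSITIVITY OF THE PLAQUETTE-WEIGHTED LEVEL-0 STATE IN EVERY AXIS.**  For a coordinate permutation `π`, the conjugate
site reflection `R_π U := π·Θ'(π⁻¹·U)` (in `GaugeField.permute`'s pull-back convention: `R_π U = ((U.permute π⁻¹).negReflect).permute π`;
for `π = swap 0 μ` this is the Osterwalder–Seiler site reflection of the AXIS `μ`) satisfies
`0 ≤ ⟨(F ∘ R_π)·F·∏_p w(1 − Re tr U(∂p))⟩_{P,β}` for every non-negative bounded measurable `w` and every bounded measurable `F` whose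
pull-back `F ∘ (·.permute π)` is supported in the closed positive-time half — §2 transported along the exact symmetry `permute π`
(`Missing.expect_permute`) and `prod_plaqWeight_permute`. [folklore] -/
theorem expect_conjNegReflect_mul_mul_prod_nonneg (P : Params) (β : ℝ) (π : Equiv.Perm (Fin P.d)) {w : ℝ → ℝ}
    (hw0 : ∀ t, 0 ≤ w t) (hwm : Measurable w) (hwb : ∃ K : ℝ, ∀ t, w t ≤ K)
    {F : GaugeField P 0 (Matrix.specialUnitaryGroup (Fin N) ℂ) → ℝ} (hF : Measurable F)
    (hFb : ∃ C : ℝ, ∀ U, |F U| ≤ C) (hFpos : PosHalfSupported fun V => F (V.permute π)) :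
    0 ≤ Missing.expect (G := Matrix.specialUnitaryGroup (Fin N) ℂ) P β
      (fun U => F (((U.permute π⁻¹).negReflect).permute π) * F U * ∏ p : Plaq P 0, w (1 - reTr (GaugeField.plaqHol U p))) := by
  have hFπm : Measurable fun V : GaugeField P 0 (Matrix.specialUnitaryGroup (Fin N) ℂ) => F (V.permute π) :=
    hF.comp (GaugeField.measurePreserving_permute (G := Matrix.specialUnitaryGroup (Fin N) ℂ) π).measurable
  have hFπb : ∃ C : ℝ, ∀ V : GaugeField P 0 (Matrix.specialUnitaryGroup (Fin N) ℂ), |F (V.permute π)| ≤ C := by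
    obtain ⟨C, hC⟩ := hFb
    exact ⟨C, fun V => hC _⟩
  have h := expect_negReflect_mul_mul_prod_nonneg (N := N) P β hw0 hwm hwb hFπm hFπb hFpos
  rw [← Missing.expect_permute P β π] 
  refine h.trans_eq (congrArg _ (funext fun V => ?_))
  rw [GaugeField.permute_permute, mul_inv_cancel, GaugeField.permute_one, prod_plaqWeight_permute]

/-- **THE SMALL-FIELD-RESTRICTED LEVEL-0 STATE IS REFLECTION POSITIVE IN EVERY AXIS** (`w = 𝟙[· ≤ ε]`, `π = swap 0 μ`):
`0 ≤ ⟨(F ∘ R_μ)·F·∏_p 𝟙[1 − Re tr U(∂p) ≤ ε]⟩_{P,β}` for every axis `μ`, threshold `ε`, real `β` and every bounded measurable `F` whose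
pull-back along `swap 0 μ` is positive-half supported. [folklore] -/
theorem expect_axisNegReflect_mul_mul_smallField_nonneg (P : Params) (β ε : ℝ) (μ : Fin P.d)
    {F : GaugeField P 0 (Matrix.specialUnitaryGroup (Fin N) ℂ) → ℝ} (hF : Measurable F)
    (hFb : ∃ C : ℝ, ∀ U, |F U| ≤ C) (hFpos : PosHalfSupported fun V => F (V.permute (Equiv.swap 0 μ))) :
    0 ≤ Missing.expect (G := Matrix.specialUnitaryGroup (Fin N) ℂ) P β
      (fun U => F (((U.permute (Equiv.swap 0 μ)⁻¹).negReflect).permute (Equiv.swap 0 μ)) * F U *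
        ∏ p : Plaq P 0, (if 1 - reTr (GaugeField.plaqHol U p) ≤ ε then (1 : ℝ) else 0)) :=
  expect_conjNegReflect_mul_mul_prod_nonneg (N := N) P β (Equiv.swap 0 μ) (w := fun t => if t ≤ ε then (1 : ℝ) else 0)
    (fun t => by split_ifs <;> norm_num) (Measurable.ite measurableSet_Iic measurable_const measurable_const)
    ⟨1, fun t => by split_ifs <;> norm_num⟩ hF hFb hFpos

end AllAxes

end Summit.QuantumFields.YangMills.BalabanUVNodes.N20LCSRestrictedRP

end
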